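import Mathlib
import Summits.ResolutionOfSingularities.ResolutionOfSingularities.Theorems.RadicialJungCleanModelsCentreBlowupChart
import Summits.ResolutionOfSingularities.ResolutionOfSingularities.Theorems.RadicialJungCleanModelsStubExtendParameter
import Literature.FieldTheory.Separability.FormallySmoothAlgebraic
import HarnessLib

/-!
# Route `RadicialJung`, crux `CleanModels` (stmt-ResolutionOfSingularities-15917), line `Sketch` rev 18, stub 4e
# `stub_cleanPrincipalization3`: cleanness survives the blowing up of a CLEAN-PERMISSIBLE regular centre — chart algebra, II

Continuation of `RadicialJungCleanModelsCentreBlowupChart.lean` (same abstract chart data `(A, ψ, u_k, ε, 𝔓, L)` of the blowing up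
of a regular local ring `R` along the part `c` of a regular system of parameters `(c, w)`, in the `cᵢ`-chart).  PROVED here:

* `looseCleanForm_centreChart_of_form_two` — **form (2) survives**: a unit `u ∈ R` whose residue is not a `p`-th power stays loosely
  clean at `L` (a derivation `D₀` of the residue field `κ(R)` with `D₀ ū = 1` — the `p`-basis theorem in its weakest form,
  `exists_derivation_apply_eq_one_of_forall_pow_ne` — extended coefficientwise to `κ(R)[T_k : k ≠ i]`, read through the reduction
  `A → (R/I)[T] → κ(R)[T]`; Leibniz obstruction);
* `looseCleanForm_reesCentreChart_of_monomial`, `looseCleanForm_reesCentreChart_of_form_two` — the specialisation to the Rees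
  chart `A = (R[It])_{(cᵢ t)}` (`chartRing`, `chartBase`, `chartGen`, `chartQuotEquiv`), `L` any localisation at a prime over `𝔪`
  presented by a ring map `χ` (the format of `IsBlowup.exists_reesChart_stalk`);
* `cleanRegAt_of_centreBlowupCharts` — **the local-algebra survival theorem**: if the `F^p`-line of `G` is CLEAN-PERMISSIBLE at `R`
  for the centre ideal `I` (some non-trivial representative is `f(u ∏ c_k^{a_k} ∏ w_m^{b_m})` with an exponent prime to `p`, for a
  regular system of parameters `(c, w)` with `(c) = I`, or is `f u` with `ū ∉ κ(R)^p`), and `L` is a localisation at a prime over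
  `𝔪` of a Rees chart of `Bl_I Spec R` for the generating family `c`, compatibly with `ψ : R → L` and `ι : F → F'`, then the line of
  `ι G` is clean-regular at `L` (`CleanRegAt`).

Honest framing: OURS; the curve analogue (dimension-free) of the landed 4d `stub_cleanPointBlowup`, one input of the research stub 4e;
nothing here proves resolution in characteristic `p` or any case of `CleanModels`.
-/

noncomputable section

set_option linter.dupNamespace false -- mandated namespace of this single-conjunct summit

open IsLocalRing MvPolynomial
open Literature.AlgebraicGeometry.Resolution

namespace Summit.ResolutionOfSingularities.ResolutionOfSingularities.Theorems.RadicialJung.CleanModels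

universe u

/-! ## Abstract chart data (continued): form (2) survives -/

section AbstractChart

variable {R : Type u} [CommRing R] [IsRegularLocalRing R] {n : ℕ} (c : Fin n → R) (i : Fin n) {l : ℕ} (w : Fin l → R)
  (hz : Ideal.span (Set.range (Fin.append c w)) = maximalIdeal R) (hd : (maximalIdeal R).spanFinrank = n + l)
  {A : Type u} [CommRing A] (ψ : R →+* A) (uA : Fin n → A)
  (ε : MvPolynomial {k : Fin n // k ≠ i} (R ⧸ Ideal.span (Set.range c)) ≃+* A ⧸ Ideal.span {ψ (c i)})
  (hεC : ∀ r : R, ε (C (Ideal.Quotient.mk (Ideal.span (Set.range c)) r)) = Ideal.Quotient.mk _ (ψ r))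
  (𝔓 : Ideal A) [𝔓.IsPrime] (h𝔓 : 𝔓.comap ψ = maximalIdeal R)
  (L : Type u) [CommRing L] [IsLocalRing L] [Algebra A L] [IsLocalization.AtPrime L 𝔓]
  (p : ℕ) [hp : Fact p.Prime]

include hz hd hεC h𝔓 in
/-- **Form (2) survives the blowing up along `V(c)`.**  If `u ∈ R` is a unit whose residue is not a `p`-th power
(`u - c'^p ∉ 𝔪_R` for all `c'`), then `f'(ψ u)` is loosely clean at `L`: either no `ψ(u) - c'^p` lies in `𝔪_L` (form (2)), or
such a difference is a regular parameter (form (3)) — by the Leibniz obstruction with a derivation `D₀` of the residue field `κ(R)`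
not killing `ū`, extended coefficientwise to `κ(R)[T_k : k ≠ i]` and read through the reduction `A → (R/I)[T] → κ(R)[T]`.
[cite: Piltant2013, §2 Axiom 2 (ii)] -/
theorem looseCleanForm_centreChart_of_form_two [CharP R p] {F' : Type*} [CommRing F'] (f' : L →+* F') {u : R}
    (hu : IsUnit u) (hup : ∀ c' : R, u - c' ^ p ∉ maximalIdeal R) {Y : F'}
    (hY : Y = f' (algebraMap A L (ψ u))) : LooseCleanForm p f' Y := by
  classical
  haveI := isDomain_of_isRegularLocalRing R
  haveI : CharP (ResidueField R) p := CharP.of_ringHom_of_ne_zero (residue R) p hp.out.ne_zero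
  obtain ⟨Q, hQprime, hQ⟩ := exists_prime_comap_centreChartReduction c i w hz ψ ε 𝔓 h𝔓
  haveI := hQprime
  -- the residue `ū` is not a `p`-th power
  set ū : ResidueField R := residue R u with hū
  have hūp : ∀ b : ResidueField R, b ^ p ≠ ū := by
    intro b hb
    obtain ⟨c', rfl⟩ := residue_surjective b
    rw [hū, ← map_pow, ← sub_eq_zero, ← map_sub, residue_eq_zero_iff] at hb
    exact hup c' (by rw [← neg_sub]; exact Submodule.neg_mem _ hb)
  obtain ⟨D₀, hD₀⟩ :=
    Literature.FieldTheory.Separability.exists_derivation_apply_eq_one_of_forall_pow_ne p ū hūp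
  -- the coefficient reduction `π : R/I → κ(R)` and the reduction `φ' : A → κ(R)[T]`
  have hIle : Ideal.span (Set.range c) ≤ maximalIdeal R := (isRsopPart_centre c w hz hd).span_range_le_maximalIdeal
  let π : R ⧸ Ideal.span (Set.range c) →+* ResidueField R :=
    Ideal.Quotient.lift _ (residue R) fun a ha => (residue_eq_zero_iff a).mpr (hIle ha)
  have hπ : ∀ r : R, π (Ideal.Quotient.mk _ r) = residue R r := fun r => Ideal.Quotient.lift_mk _ _ _
  have hπsurj : Function.Surjective π := Ideal.Quotient.lift_surjective_of_surjective _ _ residue_surjective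
  set φE := ε.symm.toRingHom.comp (Ideal.Quotient.mk (Ideal.span {ψ (c i)})) with hφE
  set φ' : A →+* MvPolynomial {k : Fin n // k ≠ i} (ResidueField R) := (MvPolynomial.map π).comp φE with hφ'
  -- the prime `Q'` of `κ(R)[T]` over `𝔓`
  have hmapsurj : Function.Surjective (MvPolynomial.map (σ := {k : Fin n // k ≠ i}) π) := map_surjective π hπsurj
  have hkerQ : RingHom.ker (MvPolynomial.map (σ := {k : Fin n // k ≠ i}) π) ≤ Q := by
    rw [ker_map]
    rw [Ideal.map_le_iff_le_comap]
    intro x hx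
    obtain ⟨r, rfl⟩ := Ideal.Quotient.mk_surjective x
    rw [RingHom.mem_ker, hπ, residue_eq_zero_iff] at hx
    have h1 : ψ r ∈ 𝔓 := by rw [← h𝔓] at hx; exact hx
    rw [← hQ, Ideal.mem_comap, hφE, centreChartReduction_map c i ψ ε hεC r] at h1
    exact h1
  set Q' : Ideal (MvPolynomial {k : Fin n // k ≠ i} (ResidueField R)) := Q.map (MvPolynomial.map π) with hQ'def
  haveI hQ'prime : Q'.IsPrime := Ideal.map_isPrime_of_surjective hmapsurj hkerQ
  have hQ'Q : Q'.comap (MvPolynomial.map π) = Q := by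
    rw [hQ'def, Ideal.comap_map_of_surjective _ hmapsurj]
    exact sup_eq_left.mpr (by rwa [← RingHom.ker_eq_comap_bot])
  have hQ' : Q'.comap φ' = 𝔓 := by
    rw [hφ', ← Ideal.comap_comap, hQ'Q, hQ]
  -- the derivation `D₀ ⊗ 1` of `κ(R)[T]`
  obtain ⟨D, hDC, -⟩ := MvPolynomial.exists_derivation_C_eq_X_eq (σ := {k : Fin n // k ≠ i})
    (T := MvPolynomial {k : Fin n // k ≠ i} (ResidueField R))
    ((Algebra.linearMap (ResidueField R) (MvPolynomial {k : Fin n // k ≠ i} (ResidueField R))).compDer D₀) (fun _ => 0)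
  refine looseCleanForm_unit_of_leibniz 𝔓 L p φ' Q' hQ' D (ψ u) ?_ ?_ f' hY
  · exact fun h => Ideal.IsPrime.ne_top' (Ideal.eq_top_of_isUnit_mem 𝔓 h (hu.map ψ))
  · have h1 : φ' (ψ u) = C ū := by
      rw [hφ', RingHom.comp_apply, centreChartReduction_map c i ψ ε hεC u, map_C, hπ]
    rw [h1]
    change D (C ū) ∉ Q'
    rw [hDC]
    change Algebra.linearMap _ _ (D₀ ū) ∉ Q'
    rw [hD₀, Algebra.linearMap_apply, map_one]
    exact Q'.ne_top_iff_one.mp hQ'prime.ne_top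

end AbstractChart

/-! ## The Rees chart `(R[It])_{(cᵢ t)}` is an abstract chart datum -/

section ReesChart

variable {R : Type u} [CommRing R] [IsRegularLocalRing R] {n : ℕ} (c : Fin n → R) (i : Fin n) {l : ℕ} (w : Fin l → R)
  (hz : Ideal.span (Set.range (Fin.append c w)) = maximalIdeal R) (hd : (maximalIdeal R).spanFinrank = n + l)
  (𝔴 : Ideal (chartRing c i)) [𝔴.IsPrime] (h𝔴 : 𝔴.comap (chartBase c i) = maximalIdeal R)
  (L : Type u) [CommRing L] [IsLocalRing L] (χ : chartRing c i →+* L)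
  (hloc : @IsLocalization.AtPrime _ _ L _ χ.toAlgebra 𝔴 _)
  (p : ℕ) [hp : Fact p.Prime] [CharP R p]

include hz hd h𝔴 hloc in
/-- **The permissible monomial form survives, Rees chart** (`looseCleanForm_centreChart_of_monomial` for `A = (R[It])_{(cᵢ t)}`,
`ψ = chartBase`, `u_k = chartGen`, `ε = chartQuotEquiv`, `L = A_𝔴` presented by `χ`). [cite: Piltant2013, §2 Axiom 2 (ii)] -/
theorem looseCleanForm_reesCentreChart_of_monomial {F' : Type u} [Field F'] (f' : L →+* F')
    (hf' : Function.Injective f') (a : Fin n → ℕ) (b : Fin l → ℕ) (hab : (∃ k, ¬ p ∣ a k) ∨ (∃ m, ¬ p ∣ b m)) {u : R}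
    (hu : IsUnit u) {Y : F'} (hY : Y = f' (χ (chartBase c i (u * (∏ k, c k ^ a k) * ∏ m, w m ^ b m)))) :
    ∃ e : F', e ≠ 0 ∧ LooseCleanForm p f' (e ^ p * Y) := by
  letI := χ.toAlgebra
  haveI := hloc
  haveI := isNoetherianRing_blowupChart c i
  exact looseCleanForm_centreChart_of_monomial c i w hz hd (chartBase c i) (chartGen c i)
    (reesChartBase_apply_eq_mul_chartGen c i) (reesChartBase_mem_nonZeroDivisors _ _)
    (chartQuotEquiv c i (isQuasiRegular_centre c w hz hd)) (chartQuotMap_C c i) (chartQuotMap_X c i) 𝔴 h𝔴 L p f' hf' a b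
    hab hu hY

include hz hd h𝔴 hloc in
/-- **Form (2) survives, Rees chart** (`looseCleanForm_centreChart_of_form_two` for `A = (R[It])_{(cᵢ t)}`).
[cite: Piltant2013, §2 Axiom 2 (ii)] -/
theorem looseCleanForm_reesCentreChart_of_form_two {F' : Type*} [CommRing F'] (f' : L →+* F') {u : R} (hu : IsUnit u)
    (hup : ∀ c' : R, u - c' ^ p ∉ maximalIdeal R) {Y : F'} (hY : Y = f' (χ (chartBase c i u))) :
    LooseCleanForm p f' Y := by
  letI := χ.toAlgebra
  haveI := hloc
  exact looseCleanForm_centreChart_of_form_two c i w hz hd (chartBase c i)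
    (chartQuotEquiv c i (isQuasiRegular_centre c w hz hd)) (chartQuotMap_C c i) 𝔴 h𝔴 L p f' hu hup hY

end ReesChart

/-! ## Clean-regularity ascends to the points of the blowing up of a clean-permissible centre -/

/-- **`P_clean` ascends along the blowing up of a clean-permissible regular centre, local-algebra form.**  Let `R` be a local
ring read in a field `F` of characteristic `p` by an injective `f`, `L` a local ring read in `F'` by an injective `f'`,
`ψ : R → L` and `ι : F → F'` compatible, `I ⊆ R` an ideal, and suppose that for EVERY generating family `c` of `I` the ring `L` is a
localisation, at a prime over `𝔪_R`, of some chart `(R[It])_{(c_j t)}` of the blowing up of `Spec R` along `I`, compatibly with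
`ψ` (the output of `IsBlowup.exists_reesChart_stalk`).  If the line of `G` is CLEAN-PERMISSIBLE at `R` for `I` — `R` is regular
with a regular system of parameters `(c, w)`, `(c) = I`, and some non-trivial representative `X = Σ c_j^p G^j` is either
`f(u ∏ c_k^{a_k} ∏ w_m^{b_m})` (`u` a unit, some exponent prime to `p`) or `f u` with `ū ∉ κ(R)^p` — then the line of `ι G` is
clean-regular at `L`: `L` is regular (`isRegularLocalRing_chart`), and `e^p ι(X)` is loosely clean at `L` for some `e ≠ 0`
(`looseCleanForm_reesCentreChart_of_monomial` / `_of_form_two`), again a non-trivial representative (`exists_rep_twist`).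
[cite: Piltant2013, §2 Axiom 2 (ii) and Axiom 4] -/
theorem cleanRegAt_of_centreBlowupCharts {R : Type u} [CommRing R] [IsLocalRing R] {L : Type u} [CommRing L]
    [IsLocalRing L] {F F' : Type u} [Field F] [Field F'] (p : ℕ) [hp : Fact p.Prime] [CharP F p] [CharP F' p]
    (f : R →+* F) (hf : Function.Injective f) (f' : L →+* F') (hf' : Function.Injective f')
    (ψ : R →+* L) (ι : F →+* F') (hcomm : ∀ a, ι (f a) = f' (ψ a)) (I : Ideal R)
    (hchart : ∀ (n : ℕ) (c : Fin n → R), Ideal.span (Set.range c) = I →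
      ∃ (j : Fin n) (𝔴 : PrimeSpectrum (chartRing c j)) (χ : chartRing c j →+* L),
        (∀ a, χ (chartBase c j a) = ψ a) ∧
        @IsLocalization.AtPrime _ _ L _ χ.toAlgebra 𝔴.asIdeal _ ∧
        𝔴.asIdeal.comap (chartBase c j) = maximalIdeal R)
    {G : F} (h : ∃ (_ : IsRegularLocalRing R) (n l : ℕ) (c : Fin n → R) (w : Fin l → R),
      Ideal.span (Set.range (Fin.append c w)) = maximalIdeal R ∧ ringKrullDim R = ((n + l : ℕ) : WithBot ℕ∞) ∧
      Ideal.span (Set.range c) = I ∧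
      ∃ (cc : Fin p → F), (∃ j : Fin p, (j : ℕ) ≠ 0 ∧ cc j ≠ 0) ∧
        ((∃ (a : Fin n → ℕ) (b : Fin l → ℕ) (u : R), IsUnit u ∧ ((∃ k, ¬ p ∣ a k) ∨ (∃ m, ¬ p ∣ b m)) ∧
            (∑ j : Fin p, cc j ^ p * G ^ (j : ℕ)) = f (u * (∏ k, c k ^ a k) * ∏ m, w m ^ b m)) ∨
          (∃ u : R, IsUnit u ∧ (∑ j : Fin p, cc j ^ p * G ^ (j : ℕ)) = f u ∧
            ∀ c' : R, u - c' ^ p ∉ maximalIdeal R))) :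
    CleanRegAt p f' (ι G) := by
  classical
  obtain ⟨hreg, n, l, c, w, hzw, hdim, hcI, cc, hcc, hform⟩ := h
  haveI : CharP R p := f.charP hf p
  have hd : (maximalIdeal R).spanFinrank = n + l := by
    have h1 := IsRegularLocalRing.spanFinrank_maximalIdeal (R := R)
    rw [hdim] at h1
    exact_mod_cast h1
  obtain ⟨j, 𝔴, χ, hχ, hloc, hcomap⟩ := hchart n c hcI
  -- `L` is a regular local ring
  have hLreg : IsRegularLocalRing L := by
    letI := χ.toAlgebra
    haveI := hloc
    haveI := isNoetherianRing_blowupChart c j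
    exact isRegularLocalRing_chart c j w hzw hd L (chartBase c j) (chartGen c j) (reesChartBase_mem_nonZeroDivisors _ _)
      (chartQuotEquiv c j (isQuasiRegular_centre c w hzw hd)) (chartQuotMap_C c j) (chartQuotMap_X c j) 𝔴.asIdeal hcomap
  -- some twist `e^p ι(X) - dd^p` of the representative is loosely clean at `L`
  have key : ∃ e dd : F', e ≠ 0 ∧ LooseCleanForm p f' (e ^ p * ι (∑ j : Fin p, cc j ^ p * G ^ (j : ℕ)) - dd ^ p) := by
    rcases hform with ⟨a, b, u, hu, hab, hX⟩ | ⟨u, hu, hX, hup⟩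
    · obtain ⟨e, he, hclean⟩ := looseCleanForm_reesCentreChart_of_monomial c j w hzw hd 𝔴.asIdeal hcomap L χ hloc p f' hf'
        a b hab hu (Y := ι (∑ j : Fin p, cc j ^ p * G ^ (j : ℕ))) (by rw [hX, hcomm, ← hχ])
      exact ⟨e, 0, he, by rwa [zero_pow hp.out.ne_zero, sub_zero]⟩
    · refine ⟨1, 0, one_ne_zero, ?_⟩
      rw [one_pow, one_mul, zero_pow hp.out.ne_zero, sub_zero]
      exact looseCleanForm_reesCentreChart_of_form_two c j w hzw hd 𝔴.asIdeal hcomap L χ hloc p f' hu hup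
        (by rw [hX, hcomm, ← hχ])
  obtain ⟨e, dd, he, hclean⟩ := key
  obtain ⟨c', hc', hsum⟩ := exists_rep_twist p (ι G) (fun j => ι (cc j)) (by
    obtain ⟨j₀, hj₀, hcj₀⟩ := hcc
    exact ⟨j₀, hj₀, (map_ne_zero ι).mpr hcj₀⟩) e dd he
  refine ⟨hLreg, c', hc', ?_⟩
  rw [hsum]
  have hι : (∑ j : Fin p, ι (cc j) ^ p * ι G ^ (j : ℕ)) = ι (∑ j : Fin p, cc j ^ p * G ^ (j : ℕ)) := by
    simp only [map_sum, map_mul, map_pow]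
  rw [hι]
  exact hclean

end Summit.ResolutionOfSingularities.ResolutionOfSingularities.Theorems.RadicialJung.CleanModels

end
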